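import Summits.BirchSwinnertonDyer.BirchSwinnertonDyer.Theorems.EisensteinPrimesMazurMCOnCellBTypeAPeriodLadder
import Summits.BirchSwinnertonDyer.Rank1Residual.X1.MuPart
import Summits.BirchSwinnertonDyer.Rank1Residual.X2.IsogenyLineTypeGoodOrdinary
import Literature.NumberTheory.EllipticCurves.Rank1Residual.ClassX1Isogeny
import Literature.NumberTheory.EllipticCurves.CuspFormLFunctionLevelConductorProofs
import HarnessLib

/-!
# Crux `MazurMCOnX1RankZero` (stmt-BirchSwinnertonDyer-19035), line `mudescent`, stub
# `stub_analyticMuZero_offLocus` — the X1 twin of the type-A period ladder: the off-locus member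
# MINIMISES the analytic `μ`-invariant of its rank-`0` X1 class, and the stub is EQUIVALENT to
# «every rank-`0` X1 class has a member with `μ_an = 0`» (cell `bsd-eis`, seat `bsd-eis-mu-b`,
# PROGRAMME PART 1b seat (2), gen 2; CONSTRUCTION seat, open-problem grade — closes NO stub)

The open stub of line `mudescent` (ky g7, skeleton `d113fc0a…`) reads
`ClassX1 W₀ p → W₀.analyticRank = 0 → ¬ HasRamifiedOddLineAt W₀ p → X1.MuPart.AnalyticMuLE W₀ p 0`.
Seat `bsd-eis-mu-a` proved the TYPE-A PERIOD LADDER (`…CellBTypeAPeriodLadder`, p463663: at an odd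
prime of good ORDINARY or multiplicative reduction, on a `¬ GVPar` class, the member `W₀` all of whose
rational `p`-lines are unramified has `Ω(W₀) = u · p^j · Ω(W)` for every `W ∼ W₀`, `|u|_p = 1`) and
its X2 consequences (`…CellBAnalyticMuOffLocus`, p464487). This file is the X1 twin asked for there
(bsd-eis STATUS 2026-08-26 19:42:04Z) — the X1 certificate `X1.MuPart.AnalyticMuLE W p m` is read at
the FIXED level `N(W)` and at the unit root `α(W)`, so two transports are added: the conductor along
a `ℚ`-isogeny (§0, from modularity by strong multiplicity one — no Ogg–Saito schema) and the unit
root (`unitRoot_eq_of_isIsogenous`, Faltings).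

* §0 `conductorNorm_eq_of_isIsogenous_of_modular` — `N(W) = N(W₀)` for `ℚ`-isogenous globally
  minimal curves, GRANTED modularity `nonempty_modularParametrizationData` (∈ `PublishedInputs`):
  the newform of `W₀` is a newform of `W` (`IsNewformOf.of_isIsogenous`), and two newforms of `W`
  have the same level (`IsNewformOf.level_eq_level`, Atkin–Lehner strong multiplicity one, a tree
  theorem).
* §1 `analyticMuLE_of_isIsogenous_etaleEnd` — **`μ_an` is MINIMAL at the étale end** of a type-A
  good-ordinary class: `X1.MuPart.AnalyticMuLE W p m → X1.MuPart.AnalyticMuLE W₀ p m` for every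
  member `W` (equal conductors as a displayed hypothesis `hN`; `_of_modular` discharges it by §0).
* §2 `analyticMuLE_offLocus_of_isIsogenous` — the registered stub's hypotheses VERBATIM
  (`ClassX1 W₀ p`, `W₀.analyticRank = 0`, `¬ HasRamifiedOddLineAt W₀ p`) plus ONE `ℚ`-isogenous
  globally minimal `W` with `X1.MuPart.AnalyticMuLE W p m` give `X1.MuPart.AnalyticMuLE W₀ p m`:
  per pair, ANY member's census certificate yields the stub's conclusion for its class; and two
  off-locus members of one class certify each other (`analyticMuLE_zero_of_offLocus_of_offLocus`).
* §3 `stub_analyticMuZero_offLocus_iff_exists_member` — granted modularity, **the registered stub ⟺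
  «∀ rank-`0` X1 pair `(W,p)` ∃ `W′ ∼ W` globally minimal with `X1.MuPart.AnalyticMuLE W′ p 0`»**
  («⇒» by the LANDED `stub_locate`, p443510).

TYPED OBSTRUCTION (honest report, unchanged from gen 0 / mu-a / mu-c): the off-locus hypothesis buys
exactly the choice of member; the stub is the analytic face of Greenberg's Conj. 1.11 (Stevens 1989
Rem. 4.14, Greenberg–Vatsal 2000 Rem. after Cor. (3.8)) on the rank-`0` X1 classes — an expectation in
print, no theorem; per pair a certificate on any member. HONEST FRAMING: kernel theorems only (no
`def`, no new named fact, no `sorry`; modularity enters as a displayed PUBLISHED hypothesis exactly as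
in p460164/p462224); the stub and the crux stay OPEN; no label or count of the cell moves.
References: [Stevens1989] Thm. 2.3, (4.12), Rem. 4.14; [GreenbergVatsal2000] Cor. (3.8) and the Remark
after it, p. 5; [GreenbergLNM1716] Conj. 1.11, Prop. 5.7; [AtkinLehner1970] Thm. 4; [BCDTJAMS2001]
Thm. A; [Faltings1983Endlichkeit] §5 Kor. 2; HOME `run/shared/lean/pub/bsd-eis/mu-b-MEMO-1.md`.
-/

set_option autoImplicit false

-- `Summit.BirchSwinnertonDyer.BirchSwinnertonDyer.…`: the summit and its single sub-problem share a name (D-0017 layout).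
set_option linter.dupNamespace false

noncomputable section

open scoped Classical MatrixGroups ModularForm

open CongruenceSubgroup WeierstrassCurve
  Literature.NumberTheory.EllipticCurves Literature.NumberTheory.EllipticCurves.ModularForms
  Literature.NumberTheory.EllipticCurves.Rank1Residual
  Literature.NumberTheory.GaloisRepresentations
  Literature.Barriers.BirchSwinnertonDyer
  Summit.BirchSwinnertonDyer.Rank1Residual
  Summit.BirchSwinnertonDyer.Rank1Residual.X2.IsogenyLineTypeGoodOrdinary
  Summit.BirchSwinnertonDyer.BirchSwinnertonDyer.Theorems
  Summit.BirchSwinnertonDyer.BirchSwinnertonDyer.Theorems.EisensteinPrimesMazurMCOnCellBTypeAPeriodLadder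

namespace Summit.BirchSwinnertonDyer.BirchSwinnertonDyer.Theorems.EisensteinPrimesMazurMCOnX1RankZeroAnalyticMuMinimal

variable {W W₀ : WeierstrassCurve ℚ} [W.IsElliptic] [W₀.IsElliptic] [W.IsGloballyMinimal]
  [W₀.IsGloballyMinimal] {p : ℕ} [hp : Fact p.Prime]

/-! ## §0. Conductor along a `ℚ`-isogeny, from modularity (strong multiplicity one) -/

omit hp in
/-- **`ℚ`-isogenous elliptic curves have the same conductor, granted modularity.** If every globally
minimal elliptic curve has a modular parametrisation datum at level its conductor
(`nonempty_modularParametrizationData`, Breuil–Conrad–Diamond–Taylor), then for `W ∼ W₀` globally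
minimal, `N(W) = N(W₀)`: the newform of `W₀` is a newform of `W` (equal `L`-series,
`IsNewformOf.of_isIsogenous`) and two newforms of `W` live at the same level
(`IsNewformOf.level_eq_level`, Atkin–Lehner 1970 Thm. 4). No Ogg–Saito schema is used.
[cite: AtkinLehner1970, Thm. 4] [cite: BCDTJAMS2001, Theorem A] -/
theorem conductorNorm_eq_of_isIsogenous_of_modular (hmod : nonempty_modularParametrizationData)
    (hiso : IsIsogenous W W₀) : W.conductorNorm ℤ = W₀.conductorNorm ℤ := by
  haveI : NeZero (W.conductorNorm ℤ) := ⟨(W.conductorNorm_pos_holds).ne'⟩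
  haveI : NeZero (W₀.conductorNorm ℤ) := ⟨(W₀.conductorNorm_pos_holds).ne'⟩
  obtain ⟨D⟩ := hmod W
  obtain ⟨D₀⟩ := hmod W₀
  exact IsNewformOf.level_eq_level D.isNewformOf (D₀.isNewformOf.of_isIsogenous hiso)

/-! ## §1. The analytic `μ`-invariant is minimal at the étale end (X1 currency) -/

/-- **`μ_an` is minimal at the étale end of a type-A good-ordinary class (X1 certificate).** Let
`W ∼ W₀` be globally minimal, `p` odd of good ordinary reduction for `W`, `W` of type A
(`¬ GVPar W p`), every rational `p`-line of `W₀` unramified, and `N(W) = N(W₀)` (displayed; §0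
discharges it from modularity). Then for every `m`,
`X1.MuPart.AnalyticMuLE W p m → X1.MuPart.AnalyticMuLE W₀ p m` («`μ_an(W₀) ≤ μ_an(W)`»). Given the
data of the goal — the newform `f₀ ∈ S₂(Γ₀(N(W₀)))` of `W₀` and a Néron normalisation
`ϖ₀ Ω(W₀) = Ω⁺_{f₀}` — the ladder gives `Ω(W₀) = u p^j Ω(W)` (`|u|_p = 1`), so `ϖ := ϖ₀ u p^j` is a
Néron normalisation of `W` for the SAME `f₀` (a newform of `W` too), read at level `N(W) = N(W₀)`
and at the SAME unit root (`unitRoot_eq_of_isIsogenous`); a coefficient of `ϖ·L_p(f₀,α)` of norm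
`> p^{-(m+1)}` is one of `ϖ₀·L_p(f₀,α)` of norm `≥` it (`‖u p^j‖_p = p^{-j} ≤ 1`).
[cite: Stevens1989, Thm. 2.3 and (4.12), Rem. 4.14] [cite: GreenbergVatsal2000, §3, Remark after Cor. (3.8) (p. 40)]
[cite: Faltings1983Endlichkeit, §5 Korollar 2] -/
theorem analyticMuLE_of_isIsogenous_etaleEnd (hp2 : p ≠ 2) (hgood : W.HasGoodReductionAtPrime p)
    (hord : ¬ (p : ℤ) ∣ W.frobeniusTrace p) (hnpar : ¬ GVPar W p)
    (hW₀ : ∀ Φ : AddSubgroup (geomTorsion W₀ (p : ℤ)), IsRationalLine W₀ p Φ → LineUnramifiedAt W₀ p Φ)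
    (hiso : IsIsogenous W W₀) (hN : W.conductorNorm ℤ = W₀.conductorNorm ℤ) (m : ℕ)
    (hμ : X1.MuPart.AnalyticMuLE W p m) : X1.MuPart.AnalyticMuLE W₀ p m := by
  intro _ f₀ hf₀ ϖ₀ hϖ₀
  -- the certificate of `W`, moved to an arbitrary level `M = N(W)` (here `M := N(W₀)`)
  have key : ∀ (M : ℕ) (_ : W.conductorNorm ℤ = M) [NeZero M] (f : CuspForm (Gamma0 M) 2),
      IsNewformOf W f → ∀ ϖ : ℚ, (ϖ : ℝ) * W.realPeriodRat = plusPeriod f →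
        ∃ n : ℕ, (p : ℝ) ^ (-((m : ℤ) + 1)) <
          ‖PowerSeries.coeff n
            (PowerSeries.C ((ϖ : ℚ) : ℚ_[p]) * padicLFunction f (unitRoot W p : ℚ_[p]))‖ := by
    intro M hM _ f hf ϖ hϖ
    subst hM
    exact hμ f hf ϖ hϖ
  -- the same newform for `W`
  have hf : IsNewformOf W f₀ := hf₀.of_isIsogenous hiso
  -- the ladder
  obtain ⟨u, j, hu, hΩ⟩ :=
    exists_unit_pow_of_isIsogenous_etaleEnd hp2 (Or.inl ⟨hgood, hord⟩) hnpar hf hW₀ hiso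
  -- the Néron normalisation of `W`
  set ϖ : ℚ := ϖ₀ * (u * (p : ℚ) ^ j) with hϖdef
  have hϖ : (ϖ : ℝ) * W.realPeriodRat = plusPeriod f₀ := by
    rw [← hϖ₀, hΩ, hϖdef]; push_cast; ring
  obtain ⟨k, hk⟩ := key (W₀.conductorNorm ℤ) hN f₀ hf ϖ hϖ
  refine ⟨k, lt_of_lt_of_le hk ?_⟩
  -- same unit root; `‖ϖ L_k‖ = ‖ϖ₀‖ · ‖u‖ · ‖p‖^j · ‖L_k‖ ≤ ‖ϖ₀ L_k‖`
  rw [unitRoot_eq_of_isIsogenous hiso hgood]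
  have hcast : ((ϖ : ℚ) : ℚ_[p]) = ((ϖ₀ : ℚ) : ℚ_[p]) * (((u : ℚ) : ℚ_[p]) * (p : ℚ_[p]) ^ j) := by
    rw [hϖdef]; push_cast; ring
  rw [PowerSeries.coeff_C_mul, PowerSeries.coeff_C_mul, hcast, norm_mul, norm_mul, norm_mul, norm_mul,
    hu, one_mul, norm_pow]
  have hle : ‖(p : ℚ_[p])‖ ^ j ≤ 1 := pow_le_one₀ (norm_nonneg _) (Padic.norm_p_lt_one).le
  calc ‖((ϖ₀ : ℚ) : ℚ_[p])‖ * ‖(p : ℚ_[p])‖ ^ j * ‖PowerSeries.coeff k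
          (padicLFunction f₀ (unitRoot W₀ p : ℚ_[p]))‖
      ≤ ‖((ϖ₀ : ℚ) : ℚ_[p])‖ * 1 * ‖PowerSeries.coeff k (padicLFunction f₀ (unitRoot W₀ p : ℚ_[p]))‖ := by
        gcongr
    _ = ‖((ϖ₀ : ℚ) : ℚ_[p])‖ * ‖PowerSeries.coeff k (padicLFunction f₀ (unitRoot W₀ p : ℚ_[p]))‖ := by
        rw [mul_one]

/-- **`μ_an` is minimal at the étale end, granted modularity** (§1 with `N(W) = N(W₀)` discharged by
§0 from `nonempty_modularParametrizationData`). [cite: Stevens1989, Thm. 2.3 and Rem. 4.14]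
[cite: AtkinLehner1970, Thm. 4] [cite: BCDTJAMS2001, Theorem A] -/
theorem analyticMuLE_of_isIsogenous_etaleEnd_of_modular (hmod : nonempty_modularParametrizationData)
    (hp2 : p ≠ 2) (hgood : W.HasGoodReductionAtPrime p) (hord : ¬ (p : ℤ) ∣ W.frobeniusTrace p)
    (hnpar : ¬ GVPar W p)
    (hW₀ : ∀ Φ : AddSubgroup (geomTorsion W₀ (p : ℤ)), IsRationalLine W₀ p Φ → LineUnramifiedAt W₀ p Φ)
    (hiso : IsIsogenous W W₀) (m : ℕ) (hμ : X1.MuPart.AnalyticMuLE W p m) :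
    X1.MuPart.AnalyticMuLE W₀ p m :=
  analyticMuLE_of_isIsogenous_etaleEnd hp2 hgood hord hnpar hW₀ hiso
    (conductorNorm_eq_of_isIsogenous_of_modular hmod hiso) m hμ

/-! ## §2. The registered stub's hypotheses: rank-`0` X1 and off the `μ`-barrier locus -/

omit hp in
/-- **The rank-`0` X1 leaf along a `ℚ`-isogeny**: `ClassX1 W₀ p`, `W₀.analyticRank = 0` and
`W ∼ W₀` give `ClassX1 W p` and `W.analyticRank = 0` (`ClassX1.of_isIsogenous`, equal `L`-functions).
[cite: Faltings1983Endlichkeit, §5 Korollar 2] -/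
theorem leaf_of_isIsogenous [Fact p.Prime] (hX1 : ClassX1 W₀ p) (hr0 : W₀.analyticRank = 0)
    (hiso : IsIsogenous W W₀) : X1.RankZero.Leaf W p :=
  ⟨ClassX1.of_isIsogenous hiso.symm_of_charZero hX1,
    (analyticRank_eq_of_isIsogenous' hiso).trans hr0⟩

/-- **The stub's conclusion from ONE member.** For `W₀` with `ClassX1 W₀ p`, `W₀.analyticRank = 0`,
`¬ HasRamifiedOddLineAt W₀ p` (VERBATIM the hypotheses of the registered `stub_analyticMuZero_offLocus`)
and any `ℚ`-isogenous globally minimal `W` with `X1.MuPart.AnalyticMuLE W p m`, granted modularity: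
`X1.MuPart.AnalyticMuLE W₀ p m`. In particular the stub's conclusion `X1.MuPart.AnalyticMuLE W₀ p 0`
follows from «`μ_an = 0`» at ANY member of the class (e.g. the census certificate at the displayed
member). The class transports along the isogeny (`ClassX1.of_isIsogenous`): `p > 2`, good ordinary,
type A at `W` (`X1.RankZero.Leaf.not_gvPar`); off the locus on type A = all lines unramified
(`forall_lineUnramifiedAt_of_not_gvPar_of_not_hasRamifiedOddLineAt`, p463663).
[cite: GreenbergVatsal2000, §3, Remark after Cor. (3.8) (p. 40)] [cite: Stevens1989, Rem. 4.14] -/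
theorem analyticMuLE_offLocus_of_isIsogenous (hmod : nonempty_modularParametrizationData)
    (hX1 : ClassX1 W₀ p) (hr0 : W₀.analyticRank = 0) (hoff : ¬ HasRamifiedOddLineAt W₀ p)
    (hiso : IsIsogenous W W₀) (m : ℕ) (hμ : X1.MuPart.AnalyticMuLE W p m) :
    X1.MuPart.AnalyticMuLE W₀ p m := by
  -- (`obtain`, not `have`: a tactic-mode `have` makes the final `exact` consume the instance binder
  -- hidden in the `def` `X1.MuPart.AnalyticMuLE` of the goal — mu-a's Lean note, STATUS 19:42:04Z)
  obtain ⟨hL₀, hL⟩ : X1.RankZero.Leaf W₀ p ∧ X1.RankZero.Leaf W p :=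
    ⟨⟨hX1, hr0⟩, leaf_of_isIsogenous hX1 hr0 hiso⟩
  obtain hX : IsClassX1 W p := isClassX1_of_classX1 hL.classX1
  exact analyticMuLE_of_isIsogenous_etaleEnd_of_modular hmod hX.two_ne hX.hasGoodReductionAtPrime
    hX.not_dvd_frobeniusTrace hL.not_gvPar
    (forall_lineUnramifiedAt_of_not_gvPar_of_not_hasRamifiedOddLineAt hL₀.not_gvPar hoff) hiso m hμ

/-- **Corollary: off-locus members of one class certify each other.** In a rank-`0` X1 class, if a
member `W′` has `μ_an = 0` then EVERY off-locus member `W ∼ W′` has `μ_an = 0` (granted modularity) —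
the stub's conclusion does not depend on WHICH off-locus member `stub_locate` returns.
[cite: Stevens1989, (4.12) and Rem. 4.14] [cite: BCDTJAMS2001, Theorem A] -/
theorem analyticMuLE_zero_of_offLocus_of_offLocus (hmod : nonempty_modularParametrizationData)
    (hX1 : ClassX1 W p) (hr0 : W.analyticRank = 0) (hoff : ¬ HasRamifiedOddLineAt W p)
    {W' : WeierstrassCurve ℚ} [W'.IsElliptic] [W'.IsGloballyMinimal] (hiso : IsIsogenous W W')
    (hμ' : X1.MuPart.AnalyticMuLE W' p 0) : X1.MuPart.AnalyticMuLE W p 0 :=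
  analyticMuLE_offLocus_of_isIsogenous hmod hX1 hr0 hoff hiso.symm_of_charZero 0 hμ'

/-! ## §3. The stub is equivalent to «every rank-`0` X1 class has a member with analytic `μ = 0`» -/

/-- **TYPED OBSTRUCTION: `stub_analyticMuZero_offLocus` ⟺ the class-wide analytic `μ = 0`
expectation (X1, rank `0`).** Granted modularity, the registered stub (LHS, verbatim its signature)
holds iff for every rank-`0` X1 pair `(W,p)` SOME globally minimal `W′ ∼ W` has `μ_an = 0` w.r.t.
its own Néron period and conductor-level newform (RHS). «⇒»: by the LANDED `stub_locate` (p443510)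
every rank-`0` X1 pair is isogenous to an off-locus `W₀`, again rank-`0` X1 (`leaf_of_isIsogenous`).
«⇐»: §2. So the off-locus restriction buys exactly the choice of member: the stub IS Stevens'
Rem. 4.14 / Greenberg–Vatsal's Remark after Cor. (3.8) / the analytic face of Greenberg's Conj. 1.11
for the rank-`0` X1 classes — no printed theorem; per pair a certificate on any member.
[cite: Stevens1989, Rem. 4.14 (p. 95)] [cite: GreenbergVatsal2000, §3, Remark after Cor. (3.8) (p. 40) and p. 5]
[cite: GreenbergLNM1716, Conj. 1.11 (p. 58)] [cite: BCDTJAMS2001, Theorem A] -/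
theorem stub_analyticMuZero_offLocus_iff_exists_member (hmod : nonempty_modularParametrizationData) :
    (∀ (W₀ : WeierstrassCurve ℚ) [W₀.IsElliptic] [W₀.IsGloballyMinimal] (p : ℕ) [Fact p.Prime],
      ClassX1 W₀ p → W₀.analyticRank = 0 → ¬ HasRamifiedOddLineAt W₀ p →
        X1.MuPart.AnalyticMuLE W₀ p 0) ↔
    (∀ (W : WeierstrassCurve ℚ) [W.IsElliptic] [W.IsGloballyMinimal] (p : ℕ) [Fact p.Prime],
      ClassX1 W p → W.analyticRank = 0 →
        ∃ (W' : WeierstrassCurve ℚ) (_ : W'.IsElliptic) (_ : W'.IsGloballyMinimal),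
          IsIsogenous W W' ∧ X1.MuPart.AnalyticMuLE W' p 0) := by
  constructor
  · intro hstub W _ _ p _ hX1 hr0
    obtain ⟨W₀, hW₀, hW₀', hiso, hoff⟩ :=
      EisensteinPrimesMazurMCOnX1RankZeroLocate.stub_locate W p hX1 hr0
    have hL₀ : X1.RankZero.Leaf W₀ p := leaf_of_isIsogenous hX1 hr0 hiso.symm_of_charZero
    exact ⟨W₀, hW₀, hW₀', hiso, hstub W₀ p hL₀.classX1 hL₀.analyticRank_eq_zero hoff⟩
  · intro hclass W₀ _ _ p _ hX1 hr0 hoff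
    obtain ⟨W', hW', hW'', hiso, hμ⟩ := hclass W₀ p hX1 hr0
    exact analyticMuLE_offLocus_of_isIsogenous hmod hX1 hr0 hoff hiso.symm_of_charZero 0 hμ

/-- **The class form located at the étale end**: granted modularity and the registered stub, every
rank-`0` X1 pair `(W,p)` has an OFF-LOCUS `ℚ`-isogenous globally minimal `W₀` with
`X1.MuPart.AnalyticMuLE W₀ p 0` — the shape line `mudescent` consumes (`stub_locate` then the stub).
Conversely such a located family of certificates is the stub (§2). Bookkeeping for the item owner.
[cite: GreenbergLNM1716, Conj. 1.11 (p. 58)] [cite: Stevens1989, Rem. 4.14 (p. 95)] -/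
theorem stub_analyticMuZero_offLocus_iff_exists_offLocus_member (hmod : nonempty_modularParametrizationData) :
    (∀ (W₀ : WeierstrassCurve ℚ) [W₀.IsElliptic] [W₀.IsGloballyMinimal] (p : ℕ) [Fact p.Prime],
      ClassX1 W₀ p → W₀.analyticRank = 0 → ¬ HasRamifiedOddLineAt W₀ p →
        X1.MuPart.AnalyticMuLE W₀ p 0) ↔
    (∀ (W : WeierstrassCurve ℚ) [W.IsElliptic] [W.IsGloballyMinimal] (p : ℕ) [Fact p.Prime],
      ClassX1 W p → W.analyticRank = 0 →
        ∃ (W₀ : WeierstrassCurve ℚ) (_ : W₀.IsElliptic) (_ : W₀.IsGloballyMinimal),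
          IsIsogenous W W₀ ∧ ¬ HasRamifiedOddLineAt W₀ p ∧ X1.MuPart.AnalyticMuLE W₀ p 0) := by
  constructor
  · intro hstub W _ _ p _ hX1 hr0
    obtain ⟨W₀, hW₀, hW₀', hiso, hoff⟩ :=
      EisensteinPrimesMazurMCOnX1RankZeroLocate.stub_locate W p hX1 hr0
    have hL₀ : X1.RankZero.Leaf W₀ p := leaf_of_isIsogenous hX1 hr0 hiso.symm_of_charZero
    exact ⟨W₀, hW₀, hW₀', hiso, hoff, hstub W₀ p hL₀.classX1 hL₀.analyticRank_eq_zero hoff⟩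
  · intro hclass W₀ _ _ p _ hX1 hr0 hoff
    obtain ⟨W', hW', hW'', hiso, -, hμ⟩ := hclass W₀ p hX1 hr0
    exact analyticMuLE_offLocus_of_isIsogenous hmod hX1 hr0 hoff hiso.symm_of_charZero 0 hμ

end Summit.BirchSwinnertonDyer.BirchSwinnertonDyer.Theorems.EisensteinPrimesMazurMCOnX1RankZeroAnalyticMuMinimal

end
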